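import Literature.NumberTheory.LFunctions.MertensTail
import Literature.NumberTheory.Sieve.BrunPureSieve
import Mathlib.Analysis.Complex.ExponentialBounds
import HarnessLib

/-!
# The sieve bound for one interval of primes

Topic `NumberTheory/Sieve`.  Fully proved: for every `ε > 0` there are `X₀` and `P₀ ≥ 2` such
that for `X ≥ X₀` and `P₀ ≤ P ≤ Q ≤ exp(√log X)`,

  `#{X ≤ n ≤ 2X : no prime p ∈ [P, Q] divides n} ≤ (1 + ε) X log P / log Q + X / (log X)³`

(`card_Icc_filter_forall_prime_not_dvd_le`).  This is the "standard sieve bound of order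
`X log P_j / log Q_j`" for "the number of integers in `[X, 2X]` that do not have a prime factor from
`[P_j, Q_j]`" of Matomäki–Radziwiłł 2016, §2, in the explicit form in which §9 of that paper uses
it ("by the fundamental lemma of the sieve, for all large enough `X`,
`∑_{X ≤ n ≤ 2X, n ∉ 𝒮} 1 ≤ (1 + 1/100) X ∑_{j ≤ J} ∏_{P_j ≤ p ≤ Q_j}(1 - 1/p) ≤ (1 + 1/100) X ∑_{j ≤ J} log P_j / log Q_j`");
it is the sieve input of `MatomakiRadziwillTheorem1.lean` (Theorem 3 ⇒ Theorem 1).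

Proof: Brun's pure sieve truncated at an even level `r ≍ log log X`
(`Literature.NumberTheory.Sieve.BrunPureSieve.brun_pure_sieve_Icc`: the sifted count is at most
`(#[X,2X]) ∏_{p}(1 - 1/p) + (Rankin tail `e_{r+1}` of the elementary symmetric functions of `1/p`)
+ (number of divisors used ≤ (#primes + 1)^r)`), the tail bound
`Literature.NumberTheory.Sieve.BrunPureSieve.esymm_le_inv_pow_mul_exp`, `(#primes + 1)^r ≤ √X` for `Q ≤ exp(√log X)`, and the
interval Mertens product bound `∏_{P ≤ p ≤ Q}(1 - 1/p) ≤ e^{6/log P} log P / log Q`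
(`Literature.NumberTheory.LFunctions.MertensBound.prod_one_sub_inv_prime_Icc_le`, from the tail form of Mertens' second theorem);
`P₀` is chosen with `e^{6/log P₀} ≤ 1 + ε/2` and `X₀` from finitely many growth conditions
(`eventually_largeX`).

## References

* K. Matomäki, M. Radziwiłł, *Multiplicative functions in short intervals*, Ann. of Math. (2)
  183 (2016), 1015–1056, doi:10.4007/annals.2016.183.3.6 (arXiv:1501.04585): §2 (arXiv p. 6,
  the sieve remark after (4)) and §9 (proof of Theorem 1, the display with `(1 + 1/100)`).
* V. Brun's pure sieve / Bonferroni inequalities: proved in `BrunPureSieve.lean` (this tree).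

## Mathlib

`Nat.primesLE`-style finsets are replaced by `primesIcc P Q = (Icc ⌈P⌉₊ ⌊Q⌋₊).filter Nat.Prime`;
asymptotic input via `isLittleO_log_rpow_atTop`, `Real.tendsto_log_atTop`; numerics via
`Real.exp_one_lt_d9`.
-/

noncomputable section

namespace Literature.NumberTheory.Sieve.IntervalSieve

open Finset Real Filter

/-- The primes of the real interval `[P, Q]`, as a `Finset ℕ`. [folklore] -/
def primesIcc (P Q : ℝ) : Finset ℕ := (Icc ⌈P⌉₊ ⌊Q⌋₊).filter Nat.Prime

/-- Membership in `primesIcc P Q`: `p` prime with `P ≤ p ≤ Q`. [folklore] -/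
theorem mem_primesIcc {P Q : ℝ} {p : ℕ} :
    p ∈ primesIcc P Q ↔ p.Prime ∧ P ≤ (p : ℝ) ∧ (p : ℝ) ≤ Q := by
  unfold primesIcc
  simp only [Finset.mem_filter, Finset.mem_Icc]
  constructor
  · rintro ⟨⟨h1, h2⟩, hp⟩
    have hQ : (0 : ℝ) ≤ Q := by
      by_contra hQ
      push Not at hQ
      rw [Nat.floor_of_nonpos hQ.le] at h2
      exact hp.ne_zero (Nat.le_zero.mp h2)
    exact ⟨hp, Nat.ceil_le.mp h1, (Nat.le_floor_iff hQ).mp h2⟩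
  · rintro ⟨hp, h1, h2⟩
    exact ⟨⟨Nat.ceil_le.mpr h1, Nat.le_floor h2⟩, hp⟩

/-- Elements of `primesIcc P Q` are prime. [folklore] -/
theorem prime_of_mem_primesIcc {P Q : ℝ} {p : ℕ} (h : p ∈ primesIcc P Q) : p.Prime :=
  (mem_primesIcc.mp h).1

/-- `#primesIcc P Q ≤ Q` (crudely: at most `⌊Q⌋` primes are `≤ Q`). [folklore] -/
theorem card_primesIcc_le {P Q : ℝ} (hQ : 0 ≤ Q) : (#(primesIcc P Q) : ℝ) ≤ Q := by
  have hsub : primesIcc P Q ⊆ Icc 1 ⌊Q⌋₊ := by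
    intro p hp
    have hp' := Finset.mem_filter.mp hp
    simp only [Finset.mem_Icc] at hp' ⊢
    exact ⟨hp'.2.one_lt.le, hp'.1.2⟩
  calc (#(primesIcc P Q) : ℝ) ≤ #(Icc 1 ⌊Q⌋₊) := by exact_mod_cast Finset.card_le_card hsub
    _ = ⌊Q⌋₊ := by simp
    _ ≤ Q := Nat.floor_le hQ


/-! ### The "X large" conditions -/

/-- The finitely many growth conditions on `X` used below hold for all large `X`. [folklore] -/
theorem eventually_largeX (K : ℝ) :
    ∀ᶠ X : ℝ in atTop, 16 ≤ X ∧ 4 ≤ Real.log X ∧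
      16 * Real.log (Real.log X) + 72 ≤ Real.sqrt (Real.log X) ∧
      K ≤ Real.sqrt X ∧ 4 * Real.log X ^ 3 ≤ Real.sqrt X := by
  have h1 : ∀ᶠ X : ℝ in atTop, 16 ≤ X := eventually_ge_atTop 16
  have h2 : ∀ᶠ X : ℝ in atTop, 4 ≤ Real.log X := Real.tendsto_log_atTop.eventually_ge_atTop 4
  -- `16 log u + 72 ≤ √u` for large `u`, transported along `u = log X → ∞`
  have h3u : ∀ᶠ u : ℝ in atTop, 16 * Real.log u + 72 ≤ Real.sqrt u := by
    have hb := (isLittleO_log_rpow_atTop (show (0 : ℝ) < 1 / 2 by norm_num)).bound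
      (show (0 : ℝ) < 1 / 32 by norm_num)
    filter_upwards [hb, eventually_ge_atTop (144 ^ 2 : ℝ), eventually_ge_atTop (1 : ℝ)]
      with u hu hu2 hu1
    rw [Real.norm_of_nonneg (Real.log_nonneg hu1),
      Real.norm_of_nonneg (Real.rpow_nonneg (by linarith) _), ← Real.sqrt_eq_rpow] at hu
    have h144 : (144 : ℝ) ≤ Real.sqrt u := by
      rw [show (144 : ℝ) = Real.sqrt (144 ^ 2) by rw [Real.sqrt_sq (by norm_num)]]
      exact Real.sqrt_le_sqrt hu2
    linarith
  have h3 : ∀ᶠ X : ℝ in atTop, 16 * Real.log (Real.log X) + 72 ≤ Real.sqrt (Real.log X) :=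
    Real.tendsto_log_atTop.eventually h3u
  have h4 : ∀ᶠ X : ℝ in atTop, K ≤ Real.sqrt X := by
    filter_upwards [eventually_ge_atTop (K ^ 2)] with X hX
    calc K ≤ |K| := le_abs_self K
      _ = Real.sqrt (K ^ 2) := (Real.sqrt_sq_eq_abs K).symm
      _ ≤ Real.sqrt X := Real.sqrt_le_sqrt hX
  have h5 : ∀ᶠ X : ℝ in atTop, 4 * Real.log X ^ 3 ≤ Real.sqrt X := by
    have hb := (isLittleO_log_rpow_rpow_atTop (3 : ℝ) (show (0 : ℝ) < 1 / 2 by norm_num)).bound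
      (show (0 : ℝ) < 1 / 4 by norm_num)
    filter_upwards [hb, eventually_ge_atTop (1 : ℝ)] with X hX hX1
    have hl : 0 ≤ Real.log X := Real.log_nonneg hX1
    rw [Real.norm_of_nonneg (Real.rpow_nonneg hl _),
      Real.norm_of_nonneg (Real.rpow_nonneg (by linarith) _), ← Real.sqrt_eq_rpow,
      show (3 : ℝ) = ((3 : ℕ) : ℝ) by norm_num, Real.rpow_natCast] at hX
    linarith
  filter_upwards [h1, h2, h3, h4, h5] with X a b c d e using ⟨a, b, c, d, e⟩

/-! ### The sieve bound -/

/-- Numerical: `e² ≤ 7.39`. [folklore] -/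
theorem exp_two_le : Real.exp 2 ≤ 7.39 := by
  have h := Real.exp_one_lt_d9
  have h0 : 0 < Real.exp 1 := Real.exp_pos 1
  rw [show (2 : ℝ) = 1 + 1 by norm_num, Real.exp_add]
  nlinarith

/-- **The standard sieve bound for one interval of primes** (Matomäki–Radziwiłł 2016, §2: "for any
`j ≤ J` the number of integers in `[X, 2X]` that do not have a prime factor from `[P_j, Q_j]` is by
a standard sieve bound of order `X log P_j / log Q_j`"; used in §9 in the form "by the fundamental
lemma of the sieve, `∑_{X ≤ n ≤ 2X, n ∉ 𝒮} 1 ≤ (1 + 1/100) X ∑_{j ≤ J} ∏_{P_j ≤ p ≤ Q_j}(1 - 1/p)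
≤ (1 + 1/100) X ∑_j log P_j / log Q_j`").  PROVED form, with the constant `1 + ε` and an additive
error: for every `ε > 0` there are `X₀` and `P₀ ≥ 2` such that for `X ≥ X₀` and
`P₀ ≤ P ≤ Q ≤ exp(√log X)`,
`#{X ≤ n ≤ 2X : p ∤ n for all primes P ≤ p ≤ Q} ≤ (1 + ε) X log P / log Q + X / (log X)³`.
Proof: Brun's pure sieve (`Literature.NumberTheory.Sieve.BrunPureSieve.brun_pure_sieve_Icc`) with `r ≍ log log X` terms,
Rankin's bound for the tail, `(#Ps + 1)^r ≤ √X`, and the Mertens product bound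
`∏_{P ≤ p ≤ Q} (1 - 1/p) ≤ e^{6/log P} log P / log Q`.
[cite: MatomakiRadziwillAnnals2016, §2 (standard sieve bound) and §9 (proof of Theorem 1)] -/
theorem card_Icc_filter_forall_prime_not_dvd_le (ε : ℝ) (hε : 0 < ε) :
    ∃ X₀ P₀ : ℝ, 2 ≤ P₀ ∧ ∀ X P Q : ℝ, X₀ ≤ X → P₀ ≤ P → P ≤ Q →
      Q ≤ Real.exp (Real.sqrt (Real.log X)) →
      (#{n ∈ Icc ⌈X⌉₊ ⌊2 * X⌋₊ | ∀ p ∈ primesIcc P Q, ¬ p ∣ n} : ℝ) ≤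
        (1 + ε) * X * (Real.log P / Real.log Q) + X / Real.log X ^ 3 := by
  set P₀ : ℝ := max 2 (Real.exp (6 / Real.log (1 + ε / 2))) with hP₀
  obtain ⟨X₀, hX₀⟩ := Filter.eventually_atTop.mp (eventually_largeX (1 + ε / 2))
  refine ⟨X₀, P₀, le_max_left _ _, ?_⟩
  intro X P Q hX hP hPQ hQE
  obtain ⟨hX16, hlog4, hll, hK, hl3⟩ := hX₀ X hX
  -- basic quantities
  have hX0 : 0 < X := by linarith
  have hlogX : 0 < Real.log X := by linarith
  set L : ℝ := Real.log (Real.log X) with hL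
  have hL1 : 1 ≤ L := by
    rw [hL, ← Real.log_exp 1]
    refine Real.log_le_log (Real.exp_pos 1) (le_trans ?_ hlog4)
    have := Real.exp_one_lt_d9; linarith
  have hsqrt2 : 2 ≤ Real.sqrt (Real.log X) := by
    rw [show (2 : ℝ) = Real.sqrt (2 ^ 2) by rw [Real.sqrt_sq (by norm_num)]]
    exact Real.sqrt_le_sqrt (by linarith)
  have hP2 : 2 ≤ P := le_trans (le_max_left _ _) hP
  have hQ2 : 2 ≤ Q := hP2.trans hPQ
  have hlogP : 0 < Real.log P := Real.log_pos (by linarith)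
  have hlogQ : 0 < Real.log Q := Real.log_pos (by linarith)
  set ρ : ℝ := Real.log P / Real.log Q with hρ
  have hρ0 : 0 ≤ ρ := div_nonneg hlogP.le hlogQ.le
  have hρ1 : ρ ≤ 1 := (div_le_one hlogQ).mpr (Real.log_le_log (by linarith) hPQ)
  -- the sifting set and the interval of integers
  set Ps := primesIcc P Q with hPs
  have hPsprime : ∀ p ∈ Ps, p.Prime := fun p hp => prime_of_mem_primesIcc hp
  set a : ℕ := ⌈X⌉₊ with ha
  set b : ℕ := ⌊2 * X⌋₊ with hb
  have ha1 : 1 ≤ a := Nat.one_le_ceil_iff.mpr hX0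
  have hab : a ≤ b + 1 := by
    refine Nat.ceil_le.mpr ?_
    have := Nat.lt_floor_add_one (2 * X)
    push_cast
    linarith
  have hlen : (b : ℝ) + 1 - a ≤ X + 1 := by
    have h1 : (b : ℝ) ≤ 2 * X := Nat.floor_le (by linarith)
    have h2 : X ≤ a := Nat.le_ceil X
    linarith
  -- the truncation level
  set r : ℕ := 2 * ⌈2 * L⌉₊ + 16 with hr
  have hr_even : Even r := ⟨⌈2 * L⌉₊ + 8, by rw [hr]; ring⟩
  have hr_ge : 4 * L + 17 ≤ (r : ℝ) + 1 := by
    have := Nat.le_ceil (2 * L)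
    rw [hr]; push_cast; linarith
  have hr_le : (r : ℝ) ≤ 4 * L + 18 := by
    have := (Nat.ceil_lt_add_one (show 0 ≤ 2 * L by linarith)).le
    rw [hr]; push_cast; linarith
  -- Brun's pure sieve
  have hbrun := Literature.NumberTheory.Sieve.BrunPureSieve.brun_pure_sieve_Icc Ps hPsprime ha1 hab hr_even
  -- (i) the main product
  have hprod : ∏ p ∈ Ps, (1 - (p : ℝ)⁻¹) ≤ (1 + ε / 2) * ρ := by
    have h1 := Literature.NumberTheory.LFunctions.MertensBound.prod_one_sub_inv_prime_Icc_le hP2 hPQ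
    have h2 : Real.exp (6 / Real.log P) ≤ 1 + ε / 2 := by
      have hε2 : 0 < Real.log (1 + ε / 2) := Real.log_pos (by linarith)
      have hP' : Real.exp (6 / Real.log (1 + ε / 2)) ≤ P := le_trans (le_max_right _ _) hP
      have hlogP' : 6 / Real.log (1 + ε / 2) ≤ Real.log P := by
        rw [← Real.log_exp (6 / Real.log (1 + ε / 2))]
        exact Real.log_le_log (Real.exp_pos _) hP'
      have h6 : 6 / Real.log P ≤ Real.log (1 + ε / 2) := by
        rw [div_le_iff₀ hlogP]
        rw [div_le_iff₀ hε2] at hlogP'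
        linarith
      calc Real.exp (6 / Real.log P) ≤ Real.exp (Real.log (1 + ε / 2)) := Real.exp_le_exp.mpr h6
        _ = 1 + ε / 2 := Real.exp_log (by linarith)
    calc ∏ p ∈ Ps, (1 - (p : ℝ)⁻¹) ≤ Real.exp (6 / Real.log P) * ρ := h1
      _ ≤ (1 + ε / 2) * ρ := mul_le_mul_of_nonneg_right h2 hρ0
  have hprod0 : 0 ≤ ∏ p ∈ Ps, (1 - (p : ℝ)⁻¹) := by
    refine Finset.prod_nonneg fun p hp => ?_
    have : (2 : ℝ) ≤ p := by exact_mod_cast (hPsprime p hp).two_le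
    rw [sub_nonneg]
    exact inv_le_one_of_one_le₀ (by linarith)
  -- (ii) the tail of the Bonferroni expansion (Rankin)
  have htail : ∑ S ∈ Ps.powersetCard (r + 1), ∏ p ∈ S, (p : ℝ)⁻¹ ≤ (Real.log X ^ 4)⁻¹ := by
    have h1 := Literature.NumberTheory.Sieve.BrunPureSieve.esymm_le_inv_pow_mul_exp Ps (fun p => (p : ℝ)⁻¹)
      (fun p _ => by positivity) (r + 1) (Real.exp_pos 2)
    have hsum : ∑ p ∈ Ps, (p : ℝ)⁻¹ ≤ L / 2 + 4 := by
      have h2 := Literature.NumberTheory.LFunctions.MertensBound.sum_inv_prime_Icc_le (P := P) hQ2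
      simp only [one_div] at h2
      have h3 : Real.log (Real.log Q) ≤ L / 2 := by
        have hlq : Real.log Q ≤ Real.sqrt (Real.log X) := by
          rw [← Real.log_exp (Real.sqrt _)]
          exact Real.log_le_log (by linarith) hQE
        calc Real.log (Real.log Q) ≤ Real.log (Real.sqrt (Real.log X)) :=
              Real.log_le_log hlogQ hlq
          _ = L / 2 := by rw [Real.log_sqrt hlogX.le, hL]
      exact le_trans h2 (by linarith)
    have hexp : ((Real.exp 2) ^ (r + 1))⁻¹ * Real.exp (Real.exp 2 * ∑ p ∈ Ps, (p : ℝ)⁻¹) ≤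
        Real.exp (-(4 * L)) := by
      rw [← Real.exp_nat_mul, ← Real.exp_neg, ← Real.exp_add]
      refine Real.exp_le_exp.mpr ?_
      have he := exp_two_le
      have h72 : Real.exp 2 * ∑ p ∈ Ps, (p : ℝ)⁻¹ ≤ 7.39 * (L / 2 + 4) :=
        mul_le_mul he hsum (Finset.sum_nonneg fun p _ => by positivity) (by norm_num)
      push_cast
      nlinarith
    have hpow : Real.exp (-(4 * L)) = (Real.log X ^ 4)⁻¹ := by
      rw [Real.exp_neg, hL, show (4 : ℝ) * Real.log (Real.log X) = ((4 : ℕ) : ℝ) * Real.log (Real.log X)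
        by norm_num, Real.exp_nat_mul, Real.exp_log hlogX]
    exact h1.trans (hexp.trans hpow.le)
  -- (iii) the number of terms
  have hterms : ∑ k ∈ range (r + 1), ((#Ps).choose k : ℝ) ≤ Real.sqrt X := by
    have h1 := Literature.NumberTheory.Sieve.BrunPureSieve.sum_range_choose_le_pow (#Ps) r
    have hcard : (#Ps : ℝ) + 1 ≤ Real.exp (2 * Real.sqrt (Real.log X)) := by
      have hc := card_primesIcc_le (P := P) (show (0 : ℝ) ≤ Q by linarith)
      have hE2 : (2 : ℝ) ≤ Real.exp (Real.sqrt (Real.log X)) := by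
        have : Real.sqrt (Real.log X) ≥ 1 := by linarith
        have h' := Real.add_one_le_exp (Real.sqrt (Real.log X))
        linarith
      calc (#Ps : ℝ) + 1 ≤ Q + Q := by linarith
        _ ≤ 2 * Real.exp (Real.sqrt (Real.log X)) := by linarith
        _ ≤ Real.exp (Real.sqrt (Real.log X)) * Real.exp (Real.sqrt (Real.log X)) :=
            mul_le_mul_of_nonneg_right hE2 (Real.exp_pos _).le
        _ = Real.exp (2 * Real.sqrt (Real.log X)) := by rw [← Real.exp_add]; ring_nf
    have h2 : ((#Ps : ℝ) + 1) ^ r ≤ Real.exp (2 * Real.sqrt (Real.log X)) ^ r :=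
      pow_le_pow_left₀ (by positivity) hcard r
    have h3 : Real.exp (2 * Real.sqrt (Real.log X)) ^ r ≤ Real.sqrt X := by
      rw [← Real.exp_nat_mul]
      have h4 : (r : ℝ) * (2 * Real.sqrt (Real.log X)) ≤ Real.log X / 2 := by
        have hs := Real.sq_sqrt hlogX.le
        have h4r : 4 * (r : ℝ) ≤ Real.sqrt (Real.log X) := by linarith
        nlinarith [Real.sqrt_nonneg (Real.log X)]
      calc Real.exp ((r : ℝ) * (2 * Real.sqrt (Real.log X))) ≤ Real.exp (Real.log X / 2) :=
            Real.exp_le_exp.mpr h4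
        _ = Real.sqrt X := by
            rw [Real.sqrt_eq_rpow, Real.rpow_def_of_pos hX0]; ring_nf
    exact h1.trans (h2.trans h3)
  -- assemble
  have hmain : ((b : ℝ) + 1 - a) *
      (∏ p ∈ Ps, (1 - (p : ℝ)⁻¹) + ∑ S ∈ Ps.powersetCard (r + 1), ∏ p ∈ S, (p : ℝ)⁻¹) ≤
      (X + 1) * ((1 + ε / 2) * ρ + (Real.log X ^ 4)⁻¹) := by
    refine mul_le_mul hlen (add_le_add hprod htail) (add_nonneg hprod0 ?_) (by linarith)
    exact Finset.sum_nonneg fun S _ => Finset.prod_nonneg fun p _ => by positivity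
  have hjunk : (1 + ε / 2) * ρ + (X + 1) * (Real.log X ^ 4)⁻¹ + Real.sqrt X ≤
      X / Real.log X ^ 3 := by
    have h1 : (1 + ε / 2) * ρ ≤ Real.sqrt X := by nlinarith
    have hl3' : 0 < Real.log X ^ 3 := by positivity
    have h2 : (X + 1) * (Real.log X ^ 4)⁻¹ ≤ X / (2 * Real.log X ^ 3) := by
      rw [div_eq_mul_inv]
      have : (X + 1) * (Real.log X ^ 4)⁻¹ = ((X + 1) / Real.log X * 2) * (2 * Real.log X ^ 3)⁻¹ := by
        field_simp
      rw [this]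
      refine mul_le_mul_of_nonneg_right ?_ (by positivity)
      rw [div_mul_eq_mul_div, div_le_iff₀ hlogX]
      have := mul_le_mul_of_nonneg_left hlog4 hX0.le
      linarith
    have h3 : 2 * Real.sqrt X ≤ X / (2 * Real.log X ^ 3) := by
      rw [le_div_iff₀ (by positivity)]
      have hs0 := Real.sqrt_nonneg X
      calc 2 * Real.sqrt X * (2 * Real.log X ^ 3) = Real.sqrt X * (4 * Real.log X ^ 3) := by ring
        _ ≤ Real.sqrt X * Real.sqrt X := mul_le_mul_of_nonneg_left hl3 hs0
        _ = X := Real.mul_self_sqrt hX0.le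
    have h4 : X / (2 * Real.log X ^ 3) + X / (2 * Real.log X ^ 3) = X / Real.log X ^ 3 := by
      field_simp
      ring
    linarith
  calc (#{n ∈ Icc a b | ∀ p ∈ Ps, ¬ p ∣ n} : ℝ)
      ≤ ((b : ℝ) + 1 - a) *
          (∏ p ∈ Ps, (1 - (p : ℝ)⁻¹) + ∑ S ∈ Ps.powersetCard (r + 1), ∏ p ∈ S, (p : ℝ)⁻¹)
        + ∑ k ∈ range (r + 1), ((#Ps).choose k : ℝ) := hbrun
    _ ≤ (X + 1) * ((1 + ε / 2) * ρ + (Real.log X ^ 4)⁻¹) + Real.sqrt X := add_le_add hmain hterms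
    _ = (1 + ε / 2) * X * ρ + ((1 + ε / 2) * ρ + (X + 1) * (Real.log X ^ 4)⁻¹ + Real.sqrt X) := by
        ring
    _ ≤ (1 + ε) * X * ρ + X / Real.log X ^ 3 := by
        have h1 : (1 + ε) * X * ρ - (1 + ε / 2) * X * ρ = ε / 2 * (X * ρ) := by ring
        have h2 : 0 ≤ ε / 2 * (X * ρ) := by positivity
        linarith

end Literature.NumberTheory.Sieve.IntervalSieve

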